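import Literature.AnabelianGeometry.SemiGraphs.PSCCoveringDatumProofs
import Literature.AnabelianGeometry.SemiGraphs.PSCGraphicity
import HarnessLib

/-!
# Coverings "which correspond via `α`": transport of [CombGC] Def. 1.4 properties to `G_U`, `H_{α(U)}`

Mochizuki, *A combinatorial version of the Grothendieck conjecture*, Tohoku Math. J. **59** (2007)
[CombGC], §1.  Definition 1.4 (ii)–(iv) (pp. 10–11) quantify over "any pair of finite étale
coverings `G' → G`, `H' → H` which correspond via `α : Π_G ≅ Π_H`", and the proofs of §1 repeatedly
"replace `G`, `H` by finite étale coverings that correspond via `α`" (Thm. 1.6 (i) p. 13, (ii)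
p. 14: "by functoriality … we may always replace `G`, `H` by finite étale coverings that correspond
via `α`") [cite: MochizukiCombGC2007, Def 1.4 pp.10-11].  Over the covering datum
`PSCDatum.restrict` (`PSCCoveringDatum.lean`) this PROOF-ONLY file (plus one origin-level
statement) records that functoriality:

* `PSCCovering.restrictIso α h : ↥U ≃ₜ* ↥U'` — the isomorphism `Π_{G_U} ≅ Π_{H_{U'}}` induced by
  `α` on corresponding coverings (`U' = α(U)`), with `map_restrictIso_subgroupOf`
  (`α_U (U ∩ B) = U' ∩ α(B)`) and `map_subtype_map_restrictIso` (`α_U(V') = α(V')` in `Π_H`);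
* `IsNumericallyCuspidal.restrict`, `IsGroupTheoreticallyCuspidal.restrict`,
  `IsGroupTheoreticallyVerticial.restrict`, `IsGroupTheoreticallyEdgeLike.restrict`: if `α` has
  the property, so does `α_U` between the corresponding covering data (Def. 1.4 (ii), (iv));
* `map_subtype_vertFil / _edgeFil / _cuspFil`: the filtration `M^cusp ⊆ M^edge ⊆ M^vert` of a
  sub-covering `G_V` (Def. 1.1 (ii)) computed in the datum `G_U` agrees with the one computed in
  `G`; hence `IsVerticiallyFiltrationPreserving.restrict`, `IsEdgewise…`, `IsGraphically…`
  (Def. 1.4 (iii));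
* `RestrictOfPSCTypeHolds Ω`: the origin-level statement "a finite étale `Π_G`-covering of a
  semi-graph of anabelioids of PSC-type is of PSC-type" (Def. 1.1 (ii) p. 6, Rmk. 1.1.5 p. 8),
  to be bound BY NAME by consumers that apply `…Holds Ω` facts to coverings.

No statement here takes a side on [IUTchIII] Cor. 3.12.
-/

namespace Literature.AnabelianGeometry.SemiGraphs

open scoped Pointwise

universe u

namespace PSCCovering

variable {P : Type u} [Group P] [TopologicalSpace P] {P' : Type u} [Group P'] [TopologicalSpace P']
  (α : P ≃ₜ* P') {U : Subgroup P} {U' : Subgroup P'}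

/-- If `α(U) = U'` then `α⁻¹(U') ⊆ U`. [cite: MochizukiCombGC2007, Def 1.4(ii) p.10] -/
theorem symm_mem_of_map_eq (h : U.map α.toMulEquiv.toMonoidHom = U') (u' : U') :
    α.symm (u' : P') ∈ U := by
  obtain ⟨u, hu, hu'⟩ := (h.symm.le u'.2 : (u' : P') ∈ U.map α.toMulEquiv.toMonoidHom)
  have e : α.symm (u' : P') = u := by rw [← hu']; exact α.symm_apply_apply u
  rw [e]; exact hu

/-- The isomorphism `Π_{G_U} = U ≅ U' = Π_{H_{U'}}` induced by `α : Π_G ≅ Π_H` on finite étale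
coverings "which correspond via `α`" (`U' = α(U)`). [cite: MochizukiCombGC2007, Def 1.4(ii) p.10] -/
noncomputable def restrictIso (h : U.map α.toMulEquiv.toMonoidHom = U') : U ≃ₜ* U' where
  toFun u := ⟨α (u : P), h.le (Subgroup.mem_map_of_mem α.toMulEquiv.toMonoidHom u.2)⟩
  invFun u' := ⟨α.symm (u' : P'), symm_mem_of_map_eq α h u'⟩
  left_inv u := Subtype.ext (α.symm_apply_apply (u : P))
  right_inv u' := Subtype.ext (α.apply_symm_apply (u' : P'))
  map_mul' u v := Subtype.ext (map_mul α (u : P) v)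
  continuous_toFun := (α.continuous.comp continuous_subtype_val).subtype_mk _
  continuous_invFun := (α.symm.continuous.comp continuous_subtype_val).subtype_mk _

variable (h : U.map α.toMulEquiv.toMonoidHom = U')

/-- `restrictIso` is `α` on elements. [cite: MochizukiCombGC2007, Def 1.4(ii) p.10] -/
@[simp] theorem coe_restrictIso_apply (u : U) : ((restrictIso α h u : U') : P') = α u := rfl

/-- `α_U (U ∩ B) = U' ∩ α(B)`: the trace of `B` on `U` goes to the trace of `α(B)` on `U'`.
[cite: MochizukiCombGC2007, Def 1.4(ii) p.10] -/
theorem map_restrictIso_subgroupOf (B : Subgroup P) :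
    (B.subgroupOf U).map (restrictIso α h).toMulEquiv.toMonoidHom =
      (B.map α.toMulEquiv.toMonoidHom).subgroupOf U' := by
  ext x
  simp only [Subgroup.mem_map, Subgroup.mem_subgroupOf]
  constructor
  · rintro ⟨u, hu, rfl⟩
    exact ⟨u, hu, rfl⟩
  · rintro ⟨b, hb, hbx⟩
    refine ⟨(restrictIso α h).symm x, ?_, (restrictIso α h).apply_symm_apply x⟩
    have hx : α.symm (x : P') = b := by rw [← hbx]; exact α.symm_apply_apply b
    change α.symm (x : P') ∈ B
    rw [hx]; exact hb

/-- In `Π_H`, the image of `α_U(V')` is `α(V')`. [cite: MochizukiCombGC2007, Def 1.4(ii) p.10] -/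
theorem map_subtype_map_restrictIso (V : Subgroup U) :
    (V.map (restrictIso α h).toMulEquiv.toMonoidHom).map U'.subtype =
      (V.map U.subtype).map α.toMulEquiv.toMonoidHom := by
  rw [Subgroup.map_map, Subgroup.map_map]
  rfl

/-- The image in `Π` of an open subgroup of the open subgroup `U` is open.
[cite: MochizukiCombGC2007, Def 1.1(ii) p.6] -/
theorem isOpen_map_subtype (hU : IsOpen (U : Set P)) {V : Subgroup U} (hV : IsOpen (V : Set U)) :
    IsOpen ((V.map U.subtype : Subgroup P) : Set P) :=
  hU.isOpenMap_subtype_val _ hV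

end PSCCovering

namespace PSCDatum

open PSCCovering

variable {P : Type u} [Group P] [TopologicalSpace P] [IsTopologicalGroup P]
  {P' : Type u} [Group P'] [TopologicalSpace P'] [IsTopologicalGroup P']
  (G : PSCDatum P) (H : PSCDatum P') (α : P ≃ₜ* P')
  {U : Subgroup P} [U.FiniteIndex] (hU : IsOpen (U : Set P))
  {U' : Subgroup P'} [U'.FiniteIndex] (hU' : IsOpen (U' : Set P'))
  (h : U.map α.toMulEquiv.toMonoidHom = U')

/-! ### Def. 1.4 (iv): group-theoretic cuspidality / verticiality / edge-likeness pass to coverings -/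

omit [IsTopologicalGroup P] [IsTopologicalGroup P'] [U.FiniteIndex] [U'.FiniteIndex] in
/-- Transport pattern: a property of subgroups "`A = U ∩ B`, `B ∈ S`" is carried by `α_U` to
"`A' = U' ∩ B'`, `B' ∈ S'`" as soon as `α` carries `S` onto `S'`.
[cite: MochizukiCombGC2007, Def 1.4(iv) p.11] -/
theorem transport_traces {S : Subgroup P → Prop} {S' : Subgroup P' → Prop}
    (hto : ∀ B, S B → S' (B.map α.toMulEquiv.toMonoidHom))
    (hfrom : ∀ B', S' B' → ∃ B, S B ∧ B.map α.toMulEquiv.toMonoidHom = B') :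
    (∀ A : Subgroup U, (∃ B, S B ∧ A = B.subgroupOf U) →
        ∃ B', S' B' ∧ A.map (restrictIso α h).toMulEquiv.toMonoidHom = B'.subgroupOf U') ∧
      ∀ A' : Subgroup U', (∃ B', S' B' ∧ A' = B'.subgroupOf U') →
        ∃ A : Subgroup U, (∃ B, S B ∧ A = B.subgroupOf U) ∧
          A.map (restrictIso α h).toMulEquiv.toMonoidHom = A' := by
  constructor
  · rintro A ⟨B, hB, rfl⟩
    exact ⟨_, hto B hB, map_restrictIso_subgroupOf α h B⟩
  · rintro A' ⟨B', hB', rfl⟩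
    obtain ⟨B, hB, rfl⟩ := hfrom B' hB'
    exact ⟨B.subgroupOf U, ⟨B, hB, rfl⟩, map_restrictIso_subgroupOf α h B⟩

/-- **Def. 1.4 (iv) under "replace `G`, `H` by coverings corresponding via `α`"**: if `α` is
group-theoretically cuspidal, so is `α_U : Π_{G_U} ≅ Π_{H_{α(U)}}`.
[cite: MochizukiCombGC2007, Def 1.4(iv) p.11] -/
theorem IsGroupTheoreticallyCuspidal.restrict (hα : G.IsGroupTheoreticallyCuspidal H α) :
    (G.restrict U hU).IsGroupTheoreticallyCuspidal (H.restrict U' hU') (restrictIso α h) := by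
  obtain ⟨h₁, h₂⟩ := transport_traces α h hα.1 hα.2
  refine ⟨fun A hA => ?_, fun B hB => ?_⟩
  · obtain ⟨B', hB', e⟩ := h₁ A ((isCuspidal_restrict_iff hU A).mp hA)
    exact (isCuspidal_restrict_iff hU' _).mpr ⟨B', hB', e⟩
  · obtain ⟨A, hA, e⟩ := h₂ B ((isCuspidal_restrict_iff hU' B).mp hB)
    exact ⟨A, (isCuspidal_restrict_iff hU A).mpr hA, e⟩

/-- If `α` is group-theoretically verticial, so is `α_U` on corresponding coverings.
[cite: MochizukiCombGC2007, Def 1.4(iv) p.11] -/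
theorem IsGroupTheoreticallyVerticial.restrict (hα : G.IsGroupTheoreticallyVerticial H α) :
    (G.restrict U hU).IsGroupTheoreticallyVerticial (H.restrict U' hU') (restrictIso α h) := by
  obtain ⟨h₁, h₂⟩ := transport_traces α h hα.1 hα.2
  refine ⟨fun A hA => ?_, fun B hB => ?_⟩
  · obtain ⟨B', hB', e⟩ := h₁ A ((isVerticial_restrict_iff hU A).mp hA)
    exact (isVerticial_restrict_iff hU' _).mpr ⟨B', hB', e⟩
  · obtain ⟨A, hA, e⟩ := h₂ B ((isVerticial_restrict_iff hU' B).mp hB)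
    exact ⟨A, (isVerticial_restrict_iff hU A).mpr hA, e⟩

/-- If `α` is group-theoretically edge-like, so is `α_U` on corresponding coverings.
[cite: MochizukiCombGC2007, Def 1.4(iv) p.11] -/
theorem IsGroupTheoreticallyEdgeLike.restrict (hα : G.IsGroupTheoreticallyEdgeLike H α) :
    (G.restrict U hU).IsGroupTheoreticallyEdgeLike (H.restrict U' hU') (restrictIso α h) := by
  obtain ⟨h₁, h₂⟩ := transport_traces α h hα.1 hα.2
  refine ⟨fun A hA => ?_, fun B hB => ?_⟩
  · obtain ⟨B', hB', e⟩ := h₁ A ((isEdgeLike_restrict_iff hU A).mp hA)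
    exact (isEdgeLike_restrict_iff hU' _).mpr ⟨B', hB', e⟩
  · obtain ⟨A, hA, e⟩ := h₂ B ((isEdgeLike_restrict_iff hU' B).mp hB)
    exact ⟨A, (isEdgeLike_restrict_iff hU A).mpr hA, e⟩

/-! ### Def. 1.4 (ii): numerical cuspidality passes to coverings (profinite `Π`) -/

/-- **Def. 1.4 (ii) under "replace `G`, `H` by coverings corresponding via `α`"**: if `α` is
numerically cuspidal then so is `α_U` — every pair of coverings of `G_U`, `H_{U'}` corresponding via
`α_U` is a pair of coverings of `G`, `H` corresponding via `α`, with the same cusps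
(`restrict_cuspCount`).  `Π_G`, `Π_H` compact (profinite), so that open subgroups have finite
index. [cite: MochizukiCombGC2007, Def 1.4(ii) p.10] -/
theorem IsNumericallyCuspidal.restrict [CompactSpace P] [CompactSpace P']
    (hα : G.IsNumericallyCuspidal H α) :
    (G.restrict U hU).IsNumericallyCuspidal (H.restrict U' hU') (restrictIso α h) := by
  intro V hV
  -- the covering of `G` attached to `V ⊆ U`
  have hVo : IsOpen ((V.map U.subtype : Subgroup P) : Set P) := isOpen_map_subtype hU hV
  haveI : Finite (P ⧸ (V.map U.subtype : Subgroup P)) := Subgroup.quotient_finite_of_isOpen _ hVo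
  haveI : (V.map U.subtype : Subgroup P).FiniteIndex := Subgroup.finiteIndex_of_finite_quotient
  have hVU : (V.map U.subtype : Subgroup P) ≤ U := Subgroup.map_subtype_le V
  have eV : (V.map U.subtype).subgroupOf U = V :=
    Subgroup.comap_map_eq_self_of_injective U.subtype_injective V
  -- the corresponding covering of `H`, attached to `α(V) ⊆ U'`
  set W : Subgroup U' := V.map (restrictIso α h).toMulEquiv.toMonoidHom with hW
  have hWmap : (W.map U'.subtype : Subgroup P') = (V.map U.subtype).map α.toMulEquiv.toMonoidHom :=
    map_subtype_map_restrictIso α h V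
  have hWo : IsOpen ((W.map U'.subtype : Subgroup P') : Set P') := by
    rw [hWmap]
    exact α.toHomeomorph.isOpenMap _ hVo
  haveI : Finite (P' ⧸ (W.map U'.subtype : Subgroup P')) := Subgroup.quotient_finite_of_isOpen _ hWo
  haveI : (W.map U'.subtype : Subgroup P').FiniteIndex := Subgroup.finiteIndex_of_finite_quotient
  have hWU : (W.map U'.subtype : Subgroup P') ≤ U' := Subgroup.map_subtype_le W
  have eW : (W.map U'.subtype).subgroupOf U' = W :=
    Subgroup.comap_map_eq_self_of_injective U'.subtype_injective W
  calc (G.restrict U hU).cuspCount V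
      = (G.restrict U hU).cuspCount ((V.map U.subtype).subgroupOf U) := by rw [eV]
    _ = G.cuspCount (V.map U.subtype) := G.restrict_cuspCount U hU _ hVU
    _ = H.cuspCount ((V.map U.subtype).map α.toMulEquiv.toMonoidHom) := hα _ hVo
    _ = H.cuspCount (W.map U'.subtype) := by rw [hWmap]
    _ = (H.restrict U' hU').cuspCount ((W.map U'.subtype).subgroupOf U') :=
        (H.restrict_cuspCount U' hU' _ hWU).symm
    _ = (H.restrict U' hU').cuspCount W := by rw [eW]

/-! ### Def. 1.4 (iii): the filtration of `M_{G_V}` computed from `G_U` and from `G` agree -/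

omit [U.FiniteIndex] in
/-- Topological closure inside the closed subgroup `U` is topological closure in `Π`.
[cite: MochizukiCombGC2007, Def 1.1(ii) p.7] -/
theorem map_subtype_topologicalClosure (hUc : IsClosed (U : Set P)) (S : Subgroup U) :
    (S.topologicalClosure).map U.subtype = (S.map U.subtype).topologicalClosure := by
  apply SetLike.coe_injective
  simp only [Subgroup.coe_map, Subgroup.topologicalClosure_coe, Subgroup.coe_subtype]
  exact (hUc.isClosedEmbedding_subtypeVal.closure_image_eq _).symm

omit [TopologicalSpace P] [IsTopologicalGroup P] [U.FiniteIndex] in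
/-- The generators "`[V, V]` and the traces on `V` of a class of subgroups" of the filtration steps of
Def. 1.1 (ii), computed in `U` for traces-on-`U` of the class and pushed to `Π`, are the generators
computed in `Π`. [cite: MochizukiCombGC2007, Def 1.1(ii) p.7] -/
theorem map_subtype_filGen {S : Subgroup P → Prop} {S' : Subgroup U → Prop}
    (hS : ∀ B', S' B' ↔ ∃ B, S B ∧ B' = B.subgroupOf U) (V : Subgroup U) :
    (⁅V, V⁆ ⊔ ⨆ A' : {A' : Subgroup U // ∃ B', S' B' ∧ A' = V ⊓ B'}, (A' : Subgroup U)).map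
        U.subtype =
      ⁅V.map U.subtype, V.map U.subtype⁆ ⊔
        ⨆ A : {A : Subgroup P // ∃ B, S B ∧ A = V.map U.subtype ⊓ B}, (A : Subgroup P) := by
  rw [Subgroup.map_sup, Subgroup.map_commutator, Subgroup.map_iSup]
  congr 1
  have hVU : V.map U.subtype ≤ U := Subgroup.map_subtype_le V
  apply le_antisymm
  · refine iSup_le fun A' => ?_
    obtain ⟨A', B', hB', rfl⟩ := A'
    obtain ⟨B, hB, rfl⟩ := (hS B').mp hB'
    refine le_iSup_of_le ⟨V.map U.subtype ⊓ B, B, hB, rfl⟩ (le_of_eq ?_)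
    simp only [Subgroup.map_inf _ _ U.subtype U.subtype_injective,
      Subgroup.subgroupOf_map_subtype]
    rw [← inf_assoc, inf_eq_left.mpr (inf_le_left.trans hVU)]
  · refine iSup_le fun A => ?_
    obtain ⟨A, B, hB, rfl⟩ := A
    refine le_iSup_of_le ⟨V ⊓ B.subgroupOf U, B.subgroupOf U, (hS _).mpr ⟨B, hB, rfl⟩, rfl⟩
      (le_of_eq ?_)
    simp only [Subgroup.map_inf _ _ U.subtype U.subtype_injective,
      Subgroup.subgroupOf_map_subtype]
    rw [← inf_assoc, inf_eq_left.mpr (inf_le_left.trans hVU)]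

omit [U.FiniteIndex] in
/-- The closure version of `map_subtype_filGen`. [cite: MochizukiCombGC2007, Def 1.1(ii) p.7] -/
theorem map_subtype_filGen_closure (hUc : IsClosed (U : Set P)) {S : Subgroup P → Prop}
    {S' : Subgroup U → Prop} (hS : ∀ B', S' B' ↔ ∃ B, S B ∧ B' = B.subgroupOf U) (V : Subgroup U) :
    (Subgroup.topologicalClosure
        (⁅V, V⁆ ⊔ ⨆ A' : {A' : Subgroup U // ∃ B', S' B' ∧ A' = V ⊓ B'}, (A' : Subgroup U))).map
        U.subtype =
      Subgroup.topologicalClosure (⁅V.map U.subtype, V.map U.subtype⁆ ⊔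
        ⨆ A : {A : Subgroup P // ∃ B, S B ∧ A = V.map U.subtype ⊓ B}, (A : Subgroup P)) := by
  rw [map_subtype_topologicalClosure hUc, map_subtype_filGen hS]

/-- **`M^vert` of a sub-covering**: the inverse image of `M^vert_{G_V}` computed in the datum `G_U`
(for `V ⊆ U = Π_{G_U}`) is, pushed into `Π_G`, the one computed in `G`.
[cite: MochizukiCombGC2007, Def 1.1(ii) p.7] -/
theorem map_subtype_vertFil (V : Subgroup U) :
    ((G.restrict U hU).vertFil V).map U.subtype = G.vertFil (V.map U.subtype) :=
  map_subtype_filGen_closure (Subgroup.isClosed_of_isOpen U hU) (S := G.IsVerticial)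
    (fun B' => isVerticial_restrict_iff hU B') V

/-- **`M^edge` of a sub-covering**, same statement. [cite: MochizukiCombGC2007, Def 1.1(ii) p.7] -/
theorem map_subtype_edgeFil (V : Subgroup U) :
    ((G.restrict U hU).edgeFil V).map U.subtype = G.edgeFil (V.map U.subtype) :=
  map_subtype_filGen_closure (Subgroup.isClosed_of_isOpen U hU) (S := G.IsEdgeLike)
    (fun B' => isEdgeLike_restrict_iff hU B') V

/-- **`M^cusp` of a sub-covering**, same statement. [cite: MochizukiCombGC2007, Def 1.1(ii) p.7] -/
theorem map_subtype_cuspFil (V : Subgroup U) :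
    ((G.restrict U hU).cuspFil V).map U.subtype = G.cuspFil (V.map U.subtype) :=
  map_subtype_filGen_closure (Subgroup.isClosed_of_isOpen U hU) (S := G.IsCuspidal)
    (fun B' => isCuspidal_restrict_iff hU B') V

/-- **Def. 1.4 (iii) under "replace `G`, `H` by coverings corresponding via `α`"**: if `α` is
verticially filtration-preserving, so is `α_U`. [cite: MochizukiCombGC2007, Def 1.4(iii) p.10] -/
theorem IsVerticiallyFiltrationPreserving.restrict (hα : G.IsVerticiallyFiltrationPreserving H α) :
    (G.restrict U hU).IsVerticiallyFiltrationPreserving (H.restrict U' hU') (restrictIso α h) := by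
  intro V hV
  apply Subgroup.map_injective U'.subtype_injective
  rw [map_subtype_map_restrictIso, map_subtype_vertFil, map_subtype_vertFil,
    map_subtype_map_restrictIso]
  exact hα _ (isOpen_map_subtype hU hV)

/-- If `α` is edge-wise filtration-preserving, so is `α_U`. [cite: MochizukiCombGC2007, Def 1.4(iii) p.10] -/
theorem IsEdgewiseFiltrationPreserving.restrict (hα : G.IsEdgewiseFiltrationPreserving H α) :
    (G.restrict U hU).IsEdgewiseFiltrationPreserving (H.restrict U' hU') (restrictIso α h) := by
  intro V hV
  apply Subgroup.map_injective U'.subtype_injective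
  rw [map_subtype_map_restrictIso, map_subtype_edgeFil, map_subtype_edgeFil,
    map_subtype_map_restrictIso]
  exact hα _ (isOpen_map_subtype hU hV)

/-- If `α` is graphically filtration-preserving, so is `α_U`. [cite: MochizukiCombGC2007, Def 1.4(iii) p.10] -/
theorem IsGraphicallyFiltrationPreserving.restrict (hα : G.IsGraphicallyFiltrationPreserving H α) :
    (G.restrict U hU).IsGraphicallyFiltrationPreserving (H.restrict U' hU') (restrictIso α h) :=
  ⟨hα.1.restrict G H α hU hU' h, hα.2.restrict G H α hU hU' h⟩

/-! ### Origin-level statement: coverings of PSC-type data are of PSC-type -/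

/-- **[CombGC] Def. 1.1 (ii)** (p. 6) / **Rmk. 1.1.5** (p. 8), over the origin predicate: "a finite
étale covering of `G` that arises from an open subgroup of `Π_G`" — a "`Π_G`-covering `G' → G`",
with `Π_{G'}` that open subgroup — is again a semi-graph of anabelioids of pro-Σ PSC-type (it is
the one §1 attaches `r(G')`, `M_{G'}`, "sturdy" to): for every `G` of PSC-type and every open
subgroup `U ⊆ Π_G` of finite index, the covering datum `G_U` is of PSC-type.
[cite: MochizukiCombGC2007, Def 1.1(ii) p.6] -/
def RestrictOfPSCTypeHolds (Ω : PSCOrigin.{u}) : Prop :=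
  ∀ ⦃Q : Type u⦄ [Group Q] [TopologicalSpace Q] [IsTopologicalGroup Q] (G : PSCDatum Q)
    (U : Subgroup Q) [U.FiniteIndex] (hU : IsOpen (U : Set Q)),
    Ω.IsOfPSCType G → Ω.IsOfPSCType (G.restrict U hU)

end PSCDatum

end Literature.AnabelianGeometry.SemiGraphs
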